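import Summits.BirchSwinnertonDyer.BirchSwinnertonDyer.Theorems.Rank1ResidualJetCoreVertexExistenceOfNamedPrint
import Summits.BirchSwinnertonDyer.BirchSwinnertonDyer.Theorems.Rank1ResidualJetSection6BridgeMin
import Summits.BirchSwinnertonDyer.BirchSwinnertonDyer.Theorems.Rank1ResidualJetRingClassFields
import HarnessLib

/-!
# T1 JET (cell `bsd-jet`), road K — STRIKE K5, step 4: the Section-6 bridge WITHOUT the reading binder
# K5 — K3 ∕ K1 ∕ K4 ⟸ [McC] Prop. 5.2 + {[McC] Prop. 4.4, Poitou–Tate, [GZ86 III (3.1)]} + H63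

HONEST FRAMING (programme file §HONESTY, verbatim): «no tranche here proves BSD; ARM L moves the
LITERAL column of an r ≤ 1 census into the kernel-proved-modulo-named-print column.» THEOREMS ONLY
(seat `bsd-jet-pv-1`, session g8; `--supports stmt-BirchSwinnertonDyer-14418`, helper); nothing is
booked; 0 classes move; K1 ∕ K3 ∕ K4 stay `@[conjecture]`.

WHAT THIS FILE DOES. pv-2's bridge `JET.jetchevDivisibilityCarrier{Mult,Ne,Add}_of_prop52_of_coreVertexExistence'`
(`Rank1ResidualJetRingClassFields.lean`) reduces the three reading binders to McCallum Prop. 5.2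
(`h52`), the reading binder K5 (`hCV : JET.JetchevCoreVertexExistence` = Jetchev Prop. 5.3 read at
`p ∣ N`) and ONE hypothesis `H63` (printed Thm. 5.2 at a core vertex, the H63 line). Here K5 is
REPLACED by the kernel theorem `JET.jetchevCoreVertexExistence_lt_of_namedPrint`
(`Rank1ResidualJetCoreVertexExistenceOfNamedPrint.lean`, this seat: Prop. 5.3 at every level
`m > m(c)`, from named print {h44, hPT, hGZ}):
`jetchevDivisibilityCarrier{Mult,Ne,Add}_of_prop52_of_namedPrint_H63 : h52 → h44 → hPT → hGZ → H63 → K3 ∕ K1 ∕ K4`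
with `H63` in EXACTLY the shape of the `'` bridge — so every END FORM built on the `'` bridge re-keys
by swapping its first line. WHY `m > m(c)` SUFFICES: the minimal bridge
(`derivedPoint_divisible_of_prop52_of_section6_min`, pv-2) asks Prop. 5.3 through a predicate `Core k c`
of the caller's choosing; with `Core k c := m_∞ < k → IsGlobalCoreVertex W K ι τ p k c` the `h64` clause
is the kernel theorem when `m_∞ < k` and is witnessed by `c` itself (vacuously) otherwise, while the
`h63` clause always carries `m_∞ < k` (the printed `k := max(t, m_∞) + 1`, p. 824) and unpacks `Core` to
the genuine core vertex `H63` needs. `exists_coreVertex_of_namedPrint` is pv-2's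
`exists_coreVertex_of_coreVertexExistence` (`Rank1ResidualJetCoreVertexBridge.lean`) verbatim with K5's
call replaced by the kernel theorem (exact-depth datum from the bridge's `mdiv`, non-torsion by
`E(K[c])[p] = 0`). RESIDUAL of the bridge: {h52, h44, hPT, hGZ} + H63 — no reading binder.
References: [cite: Jetchev2008, Prop. 5.3 (p. 823), Thm. 5.2 (p. 821), Proof of Thm. 1.1 (p. 824)]
[cite: McCallumLMS1991, §4 Prop. 4.4, §5 Prop. 5.2 (p. 304)] [cite: GrossZagier1986, III (3.1)]
[cite: GrossLMS1991, §4, Lemma 4.3].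
-/

set_option autoImplicit false

noncomputable section

open scoped Classical NumberField

open WeierstrassCurve IsDedekindDomain NumberField Literature.NumberTheory.EllipticCurves
  Literature.NumberTheory.EllipticCurves.ModularForms Literature.NumberTheory.EllipticCurves.Jetchev2008
  Literature.NumberTheory.GaloisRepresentations Literature.NumberTheory.GaloisCohomology
  Summit.BirchSwinnertonDyer.Rank1Residual.X11b Summit.BirchSwinnertonDyer.Rank1Residual.X11b.Three

namespace Summit.BirchSwinnertonDyer.Rank1Residual.JET

/-- **Prop. 5.3 for the row objects at levels `k > m_∞`, from named print** — pv-2's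
`exists_coreVertex_of_coreVertexExistence` with K5 replaced by `jetchevCoreVertexExistence_lt_of_namedPrint`:
under the bridge's depth bookkeeping (`mdiv` characterised by divisibility of the derived points, `m`
from `mdiv` and `M(c) = Zhang2014.levelIndex`), for every level `k ≥ 1` with `m_∞ < k` and conductor `c`
with `m(c) = m_∞`, `m_∞ + k ≤ M(c)`: a conductor `c' ∈ Λ_{k+m_∞}` which is a core vertex for `k`
(`Jetchev2008.IsGlobalCoreVertex`) with `m(c') ≤ m_∞`. [cite: Jetchev2008, Prop. 5.3 (p. 823)]
[cite: GrossLMS1991, §4, Lemma 4.3] -/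
theorem exists_coreVertex_of_namedPrint
    (h44 : McCallum1991.prop44_localOrder_kolyvaginClass_mul_eq)
    (hPT : ∀ (K : Type) [Field K] [NumberField K], poitouTate_selmerStructure_duality_conj K)
    (hGZ : ∀ (W : WeierstrassCurve ℚ) [W.IsElliptic] [W.IsGloballyMinimal] [NeZero (W.conductorNorm ℤ)]
      (K : Type) [Field K] [NumberField K], IsImaginaryQuadratic K →
      NumberField.discr K ≠ -3 → NumberField.discr K ≠ -4 →
      SatisfiesHeegnerHypothesis (W.conductorNorm ℤ) K →
      ∀ (p : ℕ) [Fact p.Prime], p ≠ 2 → W.HasSurjectiveModNGaloisRep p →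
      ∀ (Dt : ModularParametrizationData W (W.conductorNorm ℤ)) (β : ℤ) (ι : K →+* ℂ)
      [∀ j : ℕ, NumberField (ringClassField K ι j)],
      ∃ n' : ℤ, IsCoprime (p : ℤ) n' ∧ ∀ (m : ℕ), Squarefree m →
        (∀ q ∈ m.primeFactors, Zhang2014.IsKolyvaginPrime (W.conductorNorm ℤ) W K p q) →
        ∀ (dm : KolyvaginHeegnerData Dt β ι m)
        (γ : ringClassField K ι m ≃ₐ[ℚ] ringClassField K ι m), γ ∈ ringClassGal ι m →
        ∀ v : HeightOneSpectrum (𝓞 K), ¬ (W.baseChange K).HasGoodReductionAt v →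
          n' • pointsMap (W.baseChange K) (v.adicCompletion K)
              (dm.toGeomPoints (pointGalHom W (ringClassField K ι m) γ dm.y)) ∈
            E0Receptacle (W.baseChange K) v ∧
          ∀ (ℓ : ℕ), ℓ ∈ m.primeFactors → ∀ (dm' : KolyvaginHeegnerData Dt β ι (m / ℓ))
            (hle : ringClassField K ι (m / ℓ) ≤ ringClassField K ι m),
            n' • pointsMap (W.baseChange K) (v.adicCompletion K)
                (dm.toGeomPoints (pointGalHom W (ringClassField K ι m) γ
                  (WeierstrassCurve.Affine.Point.map (W' := W)
                    ((RingClassField.inclusion ι hle).restrictScalars ℚ) dm'.y))) ∈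
              E0Receptacle (W.baseChange K) v)
    (W : WeierstrassCurve ℚ) [W.IsElliptic] [W.IsGloballyMinimal] [NeZero (W.conductorNorm ℤ)]
    (hcm : ¬ W.HasCM) (K : Type) [Field K] [NumberField K] (hK : IsImaginaryQuadratic K)
    (hD3 : NumberField.discr K ≠ -3) (hD4 : NumberField.discr K ≠ -4)
    (hH : SatisfiesHeegnerHypothesis (W.conductorNorm ℤ) K)
    (τ : K ≃ₐ[ℚ] K) (hτ : τ ≠ 1)
    (p : ℕ) [Fact p.Prime] (hp2 : p ≠ 2) (htower : ∀ n : ℕ, W.HasSurjectiveModNGaloisRep (p ^ n : ℕ))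
    (Dt : ModularParametrizationData W (W.conductorNorm ℤ)) (β : ℤ) (ι : K →+* ℂ)
    [∀ k : ℕ, NumberField (ringClassField K ι k)]
    (d₁ : KolyvaginHeegnerData Dt β ι 1) (hy : ¬ IsOfFinAddOrder d₁.derivedPoint)
    (mdiv m : {c : ℕ // Squarefree c ∧ ∀ ℓ ∈ c.primeFactors,
      Zhang2014.IsKolyvaginPrime (W.conductorNorm ℤ) W K p ℓ} → ℕ∞)
    (hchar : ∀ c (u : ℕ), (u : ℕ∞) ≤ mdiv c ↔ ∀ d : KolyvaginHeegnerData Dt β ι c.1,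
      ∃ Q : (W.baseChange (ringClassField K ι c.1)).toAffine.Point,
        ((p ^ u : ℕ) : ℤ) • Q = d.derivedPoint)
    (hmdef : ∀ c, m c = if mdiv c < Zhang2014.levelIndex W p c.1 then mdiv c else ⊤)
    (mInf k : ℕ) (c : {c : ℕ // Squarefree c ∧ ∀ ℓ ∈ c.primeFactors,
      Zhang2014.IsKolyvaginPrime (W.conductorNorm ℤ) W K p ℓ})
    (hk : 1 ≤ k) (hmc : m c = mInf) (hMc : (mInf : ℕ∞) + k ≤ Zhang2014.levelIndex W p c.1)
    (hik : mInf < k) :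
    ∃ c' : {c : ℕ // Squarefree c ∧ ∀ ℓ ∈ c.primeFactors,
        Zhang2014.IsKolyvaginPrime (W.conductorNorm ℤ) W K p ℓ},
      Jetchev2008.IsGlobalCoreVertex W K ι τ p k c'.1 ∧
      (k : ℕ∞) + mInf ≤ Zhang2014.levelIndex W p c'.1 ∧ m c' ≤ mInf := by
  have hp : p.Prime := Fact.out
  -- `mdiv c = mInf < M(c)`
  have hlt : mdiv c < Zhang2014.levelIndex W p c.1 := by
    by_contra h
    rw [hmdef, if_neg h] at hmc
    exact ENat.top_ne_coe mInf hmc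
  have hmdiv : mdiv c = mInf := by rw [hmdef, if_pos hlt] at hmc; exact hmc
  -- a datum of exact depth `mInf`
  have hDv : ∀ d : KolyvaginHeegnerData Dt β ι c.1,
      ∃ Q : (W.baseChange (ringClassField K ι c.1)).toAffine.Point,
        ((p ^ mInf : ℕ) : ℤ) • Q = d.derivedPoint := (hchar c mInf).mp hmdiv.symm.le
  have hnotDv : ¬ ∀ d : KolyvaginHeegnerData Dt β ι c.1,
      ∃ Q : (W.baseChange (ringClassField K ι c.1)).toAffine.Point,
        ((p ^ (mInf + 1) : ℕ) : ℤ) • Q = d.derivedPoint := by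
    intro h
    have := (hchar c (mInf + 1)).mpr h
    rw [hmdiv, ENat.coe_le_coe] at this
    omega
  obtain ⟨d', hnd'⟩ := not_forall.mp hnotDv
  have hdiv' := hDv d'
  -- the derived point of `d'` is not torsion: `E(K[c])[p] = 0`
  have hc0 : c.1 ≠ 0 := c.2.1.ne_zero
  have hA : ∀ R : (W.baseChange (ringClassField K ι c.1)).toAffine.Point, (p : ℤ) • R = 0 → R = 0 :=
    fun R hR ↦ X11b.RingClassNoTorsion.eq_zero_of_zsmul_pow_eq_zero_ringClassField W hK ι hc0 hp hp2
      (by simpa using htower 1) 1 R (by simpa using hR)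
  have hnt : ¬ IsOfFinAddOrder d'.derivedPoint :=
    fun hfin ↦ hnd' (exists_pow_smul_eq_of_isOfFinAddOrder hp hA hfin (mInf + 1))
  -- `c ∈ Λ_{mInf + k}`
  have hsM : ((mInf + k : ℕ) : ℕ∞) ≤ Zhang2014.levelIndex W p c.1 := by push_cast; exact hMc
  -- Prop. 5.3 at the level `k > m_∞ = m(c)`, from named print (the kernel walk)
  obtain ⟨c', d'', hsq', hℓ', hcore, -, hnd''⟩ := jetchevCoreVertexExistence_lt_of_namedPrint h44 hPT hGZ
    W hcm K hK hD3 hD4 hH τ hτ p hp2 htower Dt β ι d₁ hy k hk c.1 d' c.2.1 c.2.2 mInf hik hnt hdiv' hnd'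
    hsM
  let cc : {c : ℕ // Squarefree c ∧ ∀ ℓ ∈ c.primeFactors,
      Zhang2014.IsKolyvaginPrime (W.conductorNorm ℤ) W K p ℓ} := ⟨c', hsq', fun ℓ h ↦ (hℓ' ℓ h).1⟩
  have hM' : (k : ℕ∞) + mInf ≤ Zhang2014.levelIndex W p c' := by
    have := Zhang2014.natCast_le_levelIndex_iff.mpr fun ℓ h ↦ (hℓ' ℓ h).2
    push_cast at this
    exact this
  refine ⟨cc, hcore, hM', ?_⟩
  -- `m(c') ≤ mInf`: the datum `d''` is not divisible to depth `mInf + 1`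
  have hle : mdiv cc ≤ mInf := by
    have h1 : ¬ ((mInf + 1 : ℕ) : ℕ∞) ≤ mdiv cc := fun h ↦ hnd'' ((hchar cc (mInf + 1)).mp h d'')
    rw [not_le] at h1
    have h2 : mdiv cc < (mInf : ℕ∞) + 1 := by exact_mod_cast h1
    exact (ENat.lt_add_one_iff (ENat.coe_ne_top mInf)).mp h2
  have hlt' : mdiv cc < Zhang2014.levelIndex W p cc.1 := by
    refine lt_of_le_of_lt hle (lt_of_lt_of_le ?_ hM')
    have h1 : (mInf : ℕ∞) < (mInf : ℕ∞) + 1 :=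
      (ENat.lt_add_one_iff (ENat.coe_ne_top mInf)).mpr le_rfl
    calc (mInf : ℕ∞) < (mInf : ℕ∞) + 1 := h1
      _ ≤ (k : ℕ∞) + mInf := by
        rw [add_comm]
        exact add_le_add_left (by exact_mod_cast hk) _
  rw [hmdef, if_pos hlt']
  exact hle

/-- **K3 ⟸ McCallum Prop. 5.2 + {[McC] Prop. 4.4, Poitou–Tate, [GZ86 III (3.1)]} + H63 — NO reading
binder K5.** `H63` in exactly the shape of `jetchevDivisibilityCarrierMult_of_prop52_of_coreVertexExistence'`.
Via pv-2's minimal bridge with `Core k c := m_∞ < k → IsGlobalCoreVertex W K ι τ p k c`: the `h64` clause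
is `exists_coreVertex_of_namedPrint` when `m_∞ < k` and is witnessed by `c` itself otherwise; the `h63`
clause unpacks `Core` by its own premise `m_∞ < k`. [cite: Jetchev2008, Prop. 5.3, Thm. 5.2, Proof of Thm. 1.1 (pp. 821–824)]
[cite: McCallumLMS1991, §4 Prop. 4.4, §5 Prop. 5.2] [cite: GrossZagier1986, III (3.1)] -/
theorem jetchevDivisibilityCarrierMult_of_prop52_of_namedPrint_H63
    (h52 : McCallum1991.prop52_exists_conductor_kolyvaginClass_order_eq)
    (h44 : McCallum1991.prop44_localOrder_kolyvaginClass_mul_eq)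
    (hPT : ∀ (K : Type) [Field K] [NumberField K], poitouTate_selmerStructure_duality_conj K)
    (hGZ : ∀ (W : WeierstrassCurve ℚ) [W.IsElliptic] [W.IsGloballyMinimal] [NeZero (W.conductorNorm ℤ)]
      (K : Type) [Field K] [NumberField K], IsImaginaryQuadratic K →
      NumberField.discr K ≠ -3 → NumberField.discr K ≠ -4 →
      SatisfiesHeegnerHypothesis (W.conductorNorm ℤ) K →
      ∀ (p : ℕ) [Fact p.Prime], p ≠ 2 → W.HasSurjectiveModNGaloisRep p →
      ∀ (Dt : ModularParametrizationData W (W.conductorNorm ℤ)) (β : ℤ) (ι : K →+* ℂ)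
      [∀ j : ℕ, NumberField (ringClassField K ι j)],
      ∃ n' : ℤ, IsCoprime (p : ℤ) n' ∧ ∀ (m : ℕ), Squarefree m →
        (∀ q ∈ m.primeFactors, Zhang2014.IsKolyvaginPrime (W.conductorNorm ℤ) W K p q) →
        ∀ (dm : KolyvaginHeegnerData Dt β ι m)
        (γ : ringClassField K ι m ≃ₐ[ℚ] ringClassField K ι m), γ ∈ ringClassGal ι m →
        ∀ v : HeightOneSpectrum (𝓞 K), ¬ (W.baseChange K).HasGoodReductionAt v →
          n' • pointsMap (W.baseChange K) (v.adicCompletion K)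
              (dm.toGeomPoints (pointGalHom W (ringClassField K ι m) γ dm.y)) ∈
            E0Receptacle (W.baseChange K) v ∧
          ∀ (ℓ : ℕ), ℓ ∈ m.primeFactors → ∀ (dm' : KolyvaginHeegnerData Dt β ι (m / ℓ))
            (hle : ringClassField K ι (m / ℓ) ≤ ringClassField K ι m),
            n' • pointsMap (W.baseChange K) (v.adicCompletion K)
                (dm.toGeomPoints (pointGalHom W (ringClassField K ι m) γ
                  (WeierstrassCurve.Affine.Point.map (W' := W)
                    ((RingClassField.inclusion ι hle).restrictScalars ℚ) dm'.y))) ∈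
              E0Receptacle (W.baseChange K) v)
    (H63 : ∀ (W : WeierstrassCurve ℚ) [W.IsElliptic] [W.IsGloballyMinimal] [NeZero (W.conductorNorm ℤ)],
      ¬ W.HasCM → ∀ (K : Type) [Field K] [NumberField K], IsImaginaryQuadratic K →
      NumberField.discr K ≠ -3 → NumberField.discr K ≠ -4 →
      SatisfiesHeegnerHypothesis (W.conductorNorm ℤ) K →
      ∀ (τ : K ≃ₐ[ℚ] K), τ ≠ 1 →
      ∀ (p : ℕ) [Fact p.Prime], p ≠ 2 → W.HasMultiplicativeReductionAtPrime p →
      (∀ n : ℕ, W.HasSurjectiveModNGaloisRep (p ^ n : ℕ)) →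
      ∀ (Dt : ModularParametrizationData W (W.conductorNorm ℤ)) (β : ℤ) (ι : K →+* ℂ)
        [∀ k : ℕ, NumberField (ringClassField K ι k)]
        (d₁ : KolyvaginHeegnerData Dt β ι 1), ¬ IsOfFinAddOrder d₁.derivedPoint →
      ∀ (mdiv m : {c : ℕ // Squarefree c ∧ ∀ ℓ ∈ c.primeFactors,
          Zhang2014.IsKolyvaginPrime (W.conductorNorm ℤ) W K p ℓ} → ℕ∞),
      (∀ c (u : ℕ), (u : ℕ∞) ≤ mdiv c ↔ ∀ d : KolyvaginHeegnerData Dt β ι c.1,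
        ∃ Q : (W.baseChange (ringClassField K ι c.1)).toAffine.Point,
          ((p ^ u : ℕ) : ℤ) • Q = d.derivedPoint) →
      (∀ c, m c = if mdiv c < Zhang2014.levelIndex W p c.1 then mdiv c else ⊤) →
      ∀ mInf : ℕ, (∀ c, (mInf : ℕ∞) ≤ m c) →
        (∀ m' : ℕ, ∃ c, (m' : ℕ∞) ≤ Zhang2014.levelIndex W p c.1 ∧ m c = mInf) →
      ∀ (k : ℕ) c, 1 ≤ k → Jetchev2008.IsGlobalCoreVertex W K ι τ p k c.1 → m c = mInf →
        (k : ℕ∞) + mInf ≤ Zhang2014.levelIndex W p c.1 →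
        padicValNat p ((W.baseChange ℚ_[p]).localTamagawaNumber ℤ_[p]) < k → mInf < k →
        padicValNat p ((W.baseChange ℚ_[p]).localTamagawaNumber ℤ_[p]) ≤ mInf) :
    JetchevDivisibilityCarrierMult := by
  refine jetchevDivisibilityCarrierMult_of_prop52_of_section6_min h52 ?_
  intro W _ _ _ hcm K _ _ hK hD3 hD4 hH p _ hp2 hmult htower Dt β ι d₁ hy mdiv m hchar hmdef mInf
    hmInf hKoly
  obtain ⟨τ, hτ⟩ := exists_algEquiv_ne_one_of_isImaginaryQuadratic K hK
  haveI : ∀ k : ℕ, NumberField (ringClassField K ι k) := numberField_ringClassField K hK ι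
  refine ⟨fun k c ↦ mInf < k → Jetchev2008.IsGlobalCoreVertex W K ι τ p k c.1, ?_, ?_⟩
  · intro k c hk hmc hMc
    by_cases hik : mInf < k
    · obtain ⟨c', hcore, hM', hm'⟩ := exists_coreVertex_of_namedPrint h44 hPT hGZ W hcm K hK hD3 hD4 hH
        τ hτ p hp2 htower Dt β ι d₁ hy mdiv m hchar hmdef mInf k c hk hmc hMc hik
      exact ⟨c', fun _ ↦ hcore, hM', hm'⟩
    · exact ⟨c, fun h ↦ absurd h hik, by rw [add_comm]; exact hMc, le_of_eq hmc⟩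
  · intro k c hk hcore hmc hMc htk hik
    exact H63 W hcm K hK hD3 hD4 hH τ hτ p hp2 hmult htower Dt β ι d₁ hy mdiv m hchar hmdef mInf hmInf
      hKoly k c hk (hcore hik) hmc hMc htk hik

/-- **K1 ⟸ McCallum Prop. 5.2 + {[McC] Prop. 4.4, Poitou–Tate, [GZ86 III (3.1)]} + H63 — NO reading
binder K5** (carrier a prime `q ∣ N`, `q ≠ p`). As `jetchevDivisibilityCarrierMult_of_prop52_of_namedPrint_H63`.
[cite: Jetchev2008, Prop. 5.3, Thm. 5.2, Proof of Thm. 1.1 (pp. 821–824)] [cite: McCallumLMS1991, §5 Prop. 5.2] -/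
theorem jetchevDivisibilityCarrierNe_of_prop52_of_namedPrint_H63
    (h52 : McCallum1991.prop52_exists_conductor_kolyvaginClass_order_eq)
    (h44 : McCallum1991.prop44_localOrder_kolyvaginClass_mul_eq)
    (hPT : ∀ (K : Type) [Field K] [NumberField K], poitouTate_selmerStructure_duality_conj K)
    (hGZ : ∀ (W : WeierstrassCurve ℚ) [W.IsElliptic] [W.IsGloballyMinimal] [NeZero (W.conductorNorm ℤ)]
      (K : Type) [Field K] [NumberField K], IsImaginaryQuadratic K →
      NumberField.discr K ≠ -3 → NumberField.discr K ≠ -4 →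
      SatisfiesHeegnerHypothesis (W.conductorNorm ℤ) K →
      ∀ (p : ℕ) [Fact p.Prime], p ≠ 2 → W.HasSurjectiveModNGaloisRep p →
      ∀ (Dt : ModularParametrizationData W (W.conductorNorm ℤ)) (β : ℤ) (ι : K →+* ℂ)
      [∀ j : ℕ, NumberField (ringClassField K ι j)],
      ∃ n' : ℤ, IsCoprime (p : ℤ) n' ∧ ∀ (m : ℕ), Squarefree m →
        (∀ q ∈ m.primeFactors, Zhang2014.IsKolyvaginPrime (W.conductorNorm ℤ) W K p q) →
        ∀ (dm : KolyvaginHeegnerData Dt β ι m)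
        (γ : ringClassField K ι m ≃ₐ[ℚ] ringClassField K ι m), γ ∈ ringClassGal ι m →
        ∀ v : HeightOneSpectrum (𝓞 K), ¬ (W.baseChange K).HasGoodReductionAt v →
          n' • pointsMap (W.baseChange K) (v.adicCompletion K)
              (dm.toGeomPoints (pointGalHom W (ringClassField K ι m) γ dm.y)) ∈
            E0Receptacle (W.baseChange K) v ∧
          ∀ (ℓ : ℕ), ℓ ∈ m.primeFactors → ∀ (dm' : KolyvaginHeegnerData Dt β ι (m / ℓ))
            (hle : ringClassField K ι (m / ℓ) ≤ ringClassField K ι m),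
            n' • pointsMap (W.baseChange K) (v.adicCompletion K)
                (dm.toGeomPoints (pointGalHom W (ringClassField K ι m) γ
                  (WeierstrassCurve.Affine.Point.map (W' := W)
                    ((RingClassField.inclusion ι hle).restrictScalars ℚ) dm'.y))) ∈
              E0Receptacle (W.baseChange K) v)
    (H63 : ∀ (W : WeierstrassCurve ℚ) [W.IsElliptic] [W.IsGloballyMinimal] [NeZero (W.conductorNorm ℤ)],
      ¬ W.HasCM → ∀ (K : Type) [Field K] [NumberField K], IsImaginaryQuadratic K →
      NumberField.discr K ≠ -3 → NumberField.discr K ≠ -4 →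
      SatisfiesHeegnerHypothesis (W.conductorNorm ℤ) K →
      ∀ (τ : K ≃ₐ[ℚ] K), τ ≠ 1 →
      ∀ (p : ℕ) [Fact p.Prime], p ≠ 2 → (∀ n : ℕ, W.HasSurjectiveModNGaloisRep (p ^ n : ℕ)) →
      ∀ (Dt : ModularParametrizationData W (W.conductorNorm ℤ)) (β : ℤ) (ι : K →+* ℂ)
        [∀ k : ℕ, NumberField (ringClassField K ι k)]
        (d₁ : KolyvaginHeegnerData Dt β ι 1), ¬ IsOfFinAddOrder d₁.derivedPoint →
      ∀ (q : ℕ) [Fact q.Prime], q ∣ W.conductorNorm ℤ → q ≠ p →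
      ∀ (mdiv m : {c : ℕ // Squarefree c ∧ ∀ ℓ ∈ c.primeFactors,
          Zhang2014.IsKolyvaginPrime (W.conductorNorm ℤ) W K p ℓ} → ℕ∞),
      (∀ c (u : ℕ), (u : ℕ∞) ≤ mdiv c ↔ ∀ d : KolyvaginHeegnerData Dt β ι c.1,
        ∃ Q : (W.baseChange (ringClassField K ι c.1)).toAffine.Point,
          ((p ^ u : ℕ) : ℤ) • Q = d.derivedPoint) →
      (∀ c, m c = if mdiv c < Zhang2014.levelIndex W p c.1 then mdiv c else ⊤) →
      ∀ mInf : ℕ, (∀ c, (mInf : ℕ∞) ≤ m c) →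
        (∀ m' : ℕ, ∃ c, (m' : ℕ∞) ≤ Zhang2014.levelIndex W p c.1 ∧ m c = mInf) →
      ∀ (k : ℕ) c, 1 ≤ k → Jetchev2008.IsGlobalCoreVertex W K ι τ p k c.1 → m c = mInf →
        (k : ℕ∞) + mInf ≤ Zhang2014.levelIndex W p c.1 →
        padicValNat p ((W.baseChange ℚ_[q]).localTamagawaNumber ℤ_[q]) < k → mInf < k →
        padicValNat p ((W.baseChange ℚ_[q]).localTamagawaNumber ℤ_[q]) ≤ mInf) :
    JetchevDivisibilityCarrierNe := by
  refine jetchevDivisibilityCarrierNe_of_prop52_of_section6_min h52 ?_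
  intro W _ _ _ hcm K _ _ hK hD3 hD4 hH p _ hp2 htower Dt β ι d₁ hy q _ hqN hqp mdiv m hchar hmdef mInf
    hmInf hKoly
  obtain ⟨τ, hτ⟩ := exists_algEquiv_ne_one_of_isImaginaryQuadratic K hK
  haveI : ∀ k : ℕ, NumberField (ringClassField K ι k) := numberField_ringClassField K hK ι
  refine ⟨fun k c ↦ mInf < k → Jetchev2008.IsGlobalCoreVertex W K ι τ p k c.1, ?_, ?_⟩
  · intro k c hk hmc hMc
    by_cases hik : mInf < k
    · obtain ⟨c', hcore, hM', hm'⟩ := exists_coreVertex_of_namedPrint h44 hPT hGZ W hcm K hK hD3 hD4 hH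
        τ hτ p hp2 htower Dt β ι d₁ hy mdiv m hchar hmdef mInf k c hk hmc hMc hik
      exact ⟨c', fun _ ↦ hcore, hM', hm'⟩
    · exact ⟨c, fun h ↦ absurd h hik, by rw [add_comm]; exact hMc, le_of_eq hmc⟩
  · intro k c hk hcore hmc hMc htk hik
    exact H63 W hcm K hK hD3 hD4 hH τ hτ p hp2 htower Dt β ι d₁ hy q hqN hqp mdiv m hchar hmdef mInf
      hmInf hKoly k c hk (hcore hik) hmc hMc htk hik

/-- **K4 ⟸ McCallum Prop. 5.2 + {[McC] Prop. 4.4, Poitou–Tate, [GZ86 III (3.1)]} + H63 — NO reading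
binder K5** (carrier `p`, additive). As `jetchevDivisibilityCarrierMult_of_prop52_of_namedPrint_H63`.
[cite: Jetchev2008, Prop. 5.3, Thm. 5.2, Proof of Thm. 1.1 (pp. 821–824)] [cite: McCallumLMS1991, §5 Prop. 5.2] -/
theorem jetchevDivisibilityCarrierAdd_of_prop52_of_namedPrint_H63
    (h52 : McCallum1991.prop52_exists_conductor_kolyvaginClass_order_eq)
    (h44 : McCallum1991.prop44_localOrder_kolyvaginClass_mul_eq)
    (hPT : ∀ (K : Type) [Field K] [NumberField K], poitouTate_selmerStructure_duality_conj K)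
    (hGZ : ∀ (W : WeierstrassCurve ℚ) [W.IsElliptic] [W.IsGloballyMinimal] [NeZero (W.conductorNorm ℤ)]
      (K : Type) [Field K] [NumberField K], IsImaginaryQuadratic K →
      NumberField.discr K ≠ -3 → NumberField.discr K ≠ -4 →
      SatisfiesHeegnerHypothesis (W.conductorNorm ℤ) K →
      ∀ (p : ℕ) [Fact p.Prime], p ≠ 2 → W.HasSurjectiveModNGaloisRep p →
      ∀ (Dt : ModularParametrizationData W (W.conductorNorm ℤ)) (β : ℤ) (ι : K →+* ℂ)
      [∀ j : ℕ, NumberField (ringClassField K ι j)],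
      ∃ n' : ℤ, IsCoprime (p : ℤ) n' ∧ ∀ (m : ℕ), Squarefree m →
        (∀ q ∈ m.primeFactors, Zhang2014.IsKolyvaginPrime (W.conductorNorm ℤ) W K p q) →
        ∀ (dm : KolyvaginHeegnerData Dt β ι m)
        (γ : ringClassField K ι m ≃ₐ[ℚ] ringClassField K ι m), γ ∈ ringClassGal ι m →
        ∀ v : HeightOneSpectrum (𝓞 K), ¬ (W.baseChange K).HasGoodReductionAt v →
          n' • pointsMap (W.baseChange K) (v.adicCompletion K)
              (dm.toGeomPoints (pointGalHom W (ringClassField K ι m) γ dm.y)) ∈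
            E0Receptacle (W.baseChange K) v ∧
          ∀ (ℓ : ℕ), ℓ ∈ m.primeFactors → ∀ (dm' : KolyvaginHeegnerData Dt β ι (m / ℓ))
            (hle : ringClassField K ι (m / ℓ) ≤ ringClassField K ι m),
            n' • pointsMap (W.baseChange K) (v.adicCompletion K)
                (dm.toGeomPoints (pointGalHom W (ringClassField K ι m) γ
                  (WeierstrassCurve.Affine.Point.map (W' := W)
                    ((RingClassField.inclusion ι hle).restrictScalars ℚ) dm'.y))) ∈
              E0Receptacle (W.baseChange K) v)
    (H63 : ∀ (W : WeierstrassCurve ℚ) [W.IsElliptic] [W.IsGloballyMinimal] [NeZero (W.conductorNorm ℤ)],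
      ¬ W.HasCM → ∀ (K : Type) [Field K] [NumberField K], IsImaginaryQuadratic K →
      NumberField.discr K ≠ -3 → NumberField.discr K ≠ -4 →
      SatisfiesHeegnerHypothesis (W.conductorNorm ℤ) K →
      ∀ (τ : K ≃ₐ[ℚ] K), τ ≠ 1 →
      ∀ (p : ℕ) [Fact p.Prime], p ≠ 2 →
      ¬ W.HasGoodReductionAtPrime p → ¬ W.HasMultiplicativeReductionAtPrime p →
      (∀ n : ℕ, W.HasSurjectiveModNGaloisRep (p ^ n : ℕ)) →
      ∀ (Dt : ModularParametrizationData W (W.conductorNorm ℤ)) (β : ℤ) (ι : K →+* ℂ)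
        [∀ k : ℕ, NumberField (ringClassField K ι k)]
        (d₁ : KolyvaginHeegnerData Dt β ι 1), ¬ IsOfFinAddOrder d₁.derivedPoint →
      ∀ (mdiv m : {c : ℕ // Squarefree c ∧ ∀ ℓ ∈ c.primeFactors,
          Zhang2014.IsKolyvaginPrime (W.conductorNorm ℤ) W K p ℓ} → ℕ∞),
      (∀ c (u : ℕ), (u : ℕ∞) ≤ mdiv c ↔ ∀ d : KolyvaginHeegnerData Dt β ι c.1,
        ∃ Q : (W.baseChange (ringClassField K ι c.1)).toAffine.Point,
          ((p ^ u : ℕ) : ℤ) • Q = d.derivedPoint) →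
      (∀ c, m c = if mdiv c < Zhang2014.levelIndex W p c.1 then mdiv c else ⊤) →
      ∀ mInf : ℕ, (∀ c, (mInf : ℕ∞) ≤ m c) →
        (∀ m' : ℕ, ∃ c, (m' : ℕ∞) ≤ Zhang2014.levelIndex W p c.1 ∧ m c = mInf) →
      ∀ (k : ℕ) c, 1 ≤ k → Jetchev2008.IsGlobalCoreVertex W K ι τ p k c.1 → m c = mInf →
        (k : ℕ∞) + mInf ≤ Zhang2014.levelIndex W p c.1 →
        padicValNat p ((W.baseChange ℚ_[p]).localTamagawaNumber ℤ_[p]) < k → mInf < k →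
        padicValNat p ((W.baseChange ℚ_[p]).localTamagawaNumber ℤ_[p]) ≤ mInf) :
    JetchevDivisibilityCarrierAdd := by
  refine jetchevDivisibilityCarrierAdd_of_prop52_of_section6_min h52 ?_
  intro W _ _ _ hcm K _ _ hK hD3 hD4 hH p _ hp2 hgood hmult htower Dt β ι d₁ hy mdiv m hchar hmdef mInf
    hmInf hKoly
  obtain ⟨τ, hτ⟩ := exists_algEquiv_ne_one_of_isImaginaryQuadratic K hK
  haveI : ∀ k : ℕ, NumberField (ringClassField K ι k) := numberField_ringClassField K hK ι
  refine ⟨fun k c ↦ mInf < k → Jetchev2008.IsGlobalCoreVertex W K ι τ p k c.1, ?_, ?_⟩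
  · intro k c hk hmc hMc
    by_cases hik : mInf < k
    · obtain ⟨c', hcore, hM', hm'⟩ := exists_coreVertex_of_namedPrint h44 hPT hGZ W hcm K hK hD3 hD4 hH
        τ hτ p hp2 htower Dt β ι d₁ hy mdiv m hchar hmdef mInf k c hk hmc hMc hik
      exact ⟨c', fun _ ↦ hcore, hM', hm'⟩
    · exact ⟨c, fun h ↦ absurd h hik, by rw [add_comm]; exact hMc, le_of_eq hmc⟩
  · intro k c hk hcore hmc hMc htk hik
    exact H63 W hcm K hK hD3 hD4 hH τ hτ p hp2 hgood hmult htower Dt β ι d₁ hy mdiv m hchar hmdef mInf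
      hmInf hKoly k c hk (hcore hik) hmc hMc htk hik

end Summit.BirchSwinnertonDyer.Rank1Residual.JET

end
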